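import Mathlib
import Summits.KontsevichZagierPeriods.Zeta5Search.Families.BasicGrowthSymmetryAPI
import Summits.KontsevichZagierPeriods.Zeta5Search.Families.BasicGrowthSymmetryConvergent
import Summits.KontsevichZagierPeriods.Zeta5Search.Families.ConvergentClasses
import HarnessLib

/-!
# ζ(5) search — Families: the growth constant is an invariant of Brown's configuration CLASS (list form)

HONEST FRAMING: systematic search; no irrationality claim unless certified.  STRUCTURAL facts about the size of
Brown's basic cellular integrals [Brown2016, §1.5, §3.1] (seat P2, Families layer); nothing about the arithmetic of any
zeta value.

`Families/BasicGrowthSymmetryAPI.lean` proved that `M_σ = fSup σ` is invariant under the four dihedral symmetries of a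
seating `σ : Fin n → Fin n`; `Families/ConvergentClasses.lean` computed Brown's list-level action `act n pr r vn c` on
printed plans through the reading `ofResidues`.  This file glues the two:
* `fSup_add_natCast`, `fSup_const_sub` — relabelling by `u ↦ u + c` and by `u ↦ c − u` preserves `M`;
* **`fSup_ofResidues_act`** — `M` of the reading of `act n pr r vn c σ` equals `M` of the reading of `σ`;
* `fSup_ofSeating_eq_fSup_ofResidues` — the 1-based and 0-based readings have the same `M`;
* **`fSup_ofSeating_eq_of_equivalent`** — `Equivalent n σ τ → M(ofSeating σ) = M(ofSeating τ)`: the growth constant is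
  a function on Brown's configurations `D_{2n} \ S_n / D_{2n}` [Brown2016, Def. 3.1], so the census lists `reps5 … reps10`
  index ALL growth constants (used by `Families/ExactAtlasEight.lean`).
Standard axioms only.
-/

noncomputable section

open MeasureTheory Set Finset Filter Topology
open Literature.NumberTheory.Irrationality.Brown2016

namespace Summit.KontsevichZagierPeriods.Zeta5Search.Families.Cellular

open Fin.NatCast Fin.CommRing

variable {ℓ : ℕ}

/-- Relabelling by a rotation `u ↦ u + c` (any `c : ℤ/n`) preserves the growth constant. -/
theorem fSup_add_natCast (σ : Fin (ℓ + 3) → Fin (ℓ + 3)) (hσ : Function.Bijective σ) (c : Fin (ℓ + 3)) :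
    fSup (fun i => σ i + c) = fSup σ := by
  have h : (fun i => σ i + c) = fun i => σ i + c.val • (1 : Fin (ℓ + 3)) := by
    funext i
    congr 1
    rw [nsmul_eq_mul, mul_one, Fin.cast_val_eq_self]
  rw [h]
  exact fSup_add_nsmul σ hσ c.val

/-- Relabelling by a reflection `u ↦ c − u` (any `c : ℤ/n`) preserves the growth constant. -/
theorem fSup_const_sub (σ : Fin (ℓ + 3) → Fin (ℓ + 3)) (hσ : Function.Bijective σ) (c : Fin (ℓ + 3)) :
    fSup (fun i => c - σ i) = fSup σ := by
  have h : (fun i => c - σ i) = fun i => reflIdx (σ i) + (c - (Fin.last (ℓ + 2) - 1)) := by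
    funext i
    rw [reflIdx_eq_sub]
    abel
  rw [h, fSup_add_natCast (fun i => reflIdx (σ i)) (reflIdx_bijective.comp hσ)]
  exact fSup_reflect σ

/-- **Brown's symmetries preserve the growth constant of the reading**: for a list `σ` of length `n` whose reading is
bijective and any element `(pr, r, vn, c)` of `D_{2n} × D_{2n}`, `M(ofResidues (act n pr r vn c σ)) = M(ofResidues σ)`. -/
theorem fSup_ofResidues_act {σ : List ℕ} (hσ : σ.length = ℓ + 3)
    (hb : Function.Bijective (ofResidues (ℓ := ℓ) σ)) (pr : Bool) (r : ℕ) (vn : Bool) (c : ℕ) :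
    fSup (ofResidues (ℓ := ℓ) (act (ℓ + 3) pr r vn c σ)) = fSup (ofResidues (ℓ := ℓ) σ) := by
  have hshift : fSup (fun i => ofResidues (ℓ := ℓ) σ (i + (r : Fin (ℓ + 3)))) = fSup (ofResidues (ℓ := ℓ) σ) := by
    have e : (fun i => ofResidues (ℓ := ℓ) σ (i + (r : Fin (ℓ + 3)))) =
        fun i => ofResidues (ℓ := ℓ) σ ((r : Fin (ℓ + 3)) + i) := by
      funext i; rw [add_comm i (r : Fin (ℓ + 3))]
    rw [e]
    exact fSup_shift_const (ofResidues (ℓ := ℓ) σ) _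
  have hbs : Function.Bijective fun i => ofResidues (ℓ := ℓ) σ (i + (r : Fin (ℓ + 3))) :=
    hb.comp (Equiv.addRight (r : Fin (ℓ + 3))).bijective
  have hbr : Function.Bijective fun i =>
      ofResidues (ℓ := ℓ) σ (((((ℓ + 3 - 1 : ℕ)) : Fin (ℓ + 3)) - (r : Fin (ℓ + 3))) - i) :=
    hb.comp (Equiv.subLeft ((((ℓ + 3 - 1 : ℕ)) : Fin (ℓ + 3)) - (r : Fin (ℓ + 3)))).bijective
  cases pr <;> cases vn
  · rw [ofResidues_act_ff hσ, fSup_add_natCast _ hbs, hshift]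
  · rw [ofResidues_act_ft hσ, fSup_const_sub _ hbs, hshift]
  · rw [ofResidues_act_tf hσ, fSup_add_natCast _ hbr]
    exact fSup_reverse_const (ofResidues (ℓ := ℓ) σ) _
  · rw [ofResidues_act_tt hσ, fSup_const_sub _ hbr]
    exact fSup_reverse_const (ofResidues (ℓ := ℓ) σ) _

/-- The 0-based reading of a seating plan is bijective. -/
theorem bijective_ofResidues_of_isSeating {τ : List ℕ} (hτ : IsSeating (ℓ + 3) τ) :
    Function.Bijective (ofResidues (ℓ := ℓ) τ) := by
  have e : ofResidues (ℓ := ℓ) τ = fun i => ofSeating (ℓ := ℓ) τ i + 1 := by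
    funext i
    rw [ofSeating_eq_ofResidues_sub_one hτ, sub_add_cancel]
  rw [e]
  exact bijective_add_const _ (bijective_ofSeating hτ) 1

/-- The 1-based reading `ofSeating` and the 0-based reading `ofResidues` of a seating plan have the same growth
constant (they differ by the label rotation `u ↦ u − 1`). -/
theorem fSup_ofSeating_eq_fSup_ofResidues {τ : List ℕ} (hτ : IsSeating (ℓ + 3) τ) :
    fSup (ofSeating (ℓ := ℓ) τ) = fSup (ofResidues (ℓ := ℓ) τ) := by
  have e : ofSeating (ℓ := ℓ) τ = fun i => ofResidues (ℓ := ℓ) τ i + (-1) := by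
    funext i
    rw [ofSeating_eq_ofResidues_sub_one hτ, sub_eq_add_neg]
  rw [e]
  exact fSup_add_natCast _ (bijective_ofResidues_of_isSeating hτ) (-1)

/-- **The growth constant is a class function**: equivalent seating plans (same configuration, [Brown2016, Def. 3.1])
have the same growth constant `M`. -/
theorem fSup_ofSeating_eq_of_equivalent {σ τ : List ℕ} (hσ : IsSeating (ℓ + 3) σ) (hτ : IsSeating (ℓ + 3) τ)
    (h : Equivalent (ℓ + 3) σ τ) : fSup (ofSeating (ℓ := ℓ) σ) = fSup (ofSeating (ℓ := ℓ) τ) := by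
  unfold Equivalent equiv at h
  simp only [List.any_eq_true, beq_iff_eq] at h
  obtain ⟨pr, -, r, -, vn, -, c, -, hact⟩ := h
  rw [fSup_ofSeating_eq_fSup_ofResidues hσ, fSup_ofSeating_eq_fSup_ofResidues hτ, ← ofResidues_map_mod τ, ← hact,
    fSup_ofResidues_act (length_of_isSeating hσ) (bijective_ofResidues_of_isSeating hσ)]

end Summit.KontsevichZagierPeriods.Zeta5Search.Families.Cellular
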